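import Summits.ResolutionOfSingularities.ResolutionOfSingularities.Theorems.FrobeniusLadderFRationalResolutionTraceIdealCharacteristic
import HarnessLib

/-!
# Crux `FrobeniusLadder.FRationalResolution` (stmt-ResolutionOfSingularities-15317), line `redirect`,
# stub `stub_diagonalizableQuotientResolution` — «NONZERO DIVISORIAL» IS AN AUTOMORPHISM-INVARIANT CLASS OF IDEALS, so the
# product of the trace ideals of the nonzero divisorial ideals is CHARACTERISTIC (item (α)/(Q1) of MEMO-15317-leafhand2-g16 §3,
# abstract part; what remains of (α) is the finiteness of that set of trace ideals = finiteness of the class group)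

`…TraceIdealCharacteristic.map_prod_traceIdeal_eq` (this generation) shows that `∏_{T ∈ 𝒯_P} T` is fixed by every ring
automorphism as soon as the class `P` of ideals is transported by ring automorphisms and `𝒯_P = {τ(I) : P(I)}` is finite. Here the
class is made explicit and first order in the ring alone — no fraction field, no duals, no class group:

  `P(I) :⇔ I ≠ 0 ∧ ∀ x, (∀ a b, b·I ⊆ (a) → b·x ∈ (a)) → x ∈ I`

(«`I` is a nonzero v-ideal / DIVISORIAL ideal»: `I` contains every element lying in all principal fractional ideals `(a/b)`
containing `I`; for a domain this is `I = (I⁻¹)⁻¹ ∩ A = I_v`). Its transport under ring isomorphisms is a triviality, which is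
the point: the resulting centre needs no cocycle, cover or coordinates.

* `divisorial_map_ringEquiv` — `P(I) ⇒ P(θ(I))` for every ring isomorphism `θ`;
* ★ `forall_map_prod_traceIdeal_divisorial_le` — if the trace ideals of the nonzero divisorial ideals of `A` form a finite set
  `𝒯`, then `θ(∏_{T ∈ 𝒯} T) ⊆ ∏_{T ∈ 𝒯} T` for EVERY ring automorphism `θ` of `A` — verbatim the `hchar` hypothesis of
  `…GaloisCharacteristicCentre.hloc_of_characteristic_ideal_adicCompletion` (p838347) / `…CharacteristicTower` for `J = 𝔞_tot`
  (and for its powers, `forall_map_pow_prod_traceIdeal_divisorial_le`).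

Honest label: general commutative algebra toward ONE leaf stub (no stub, crux or summit closed). Remaining for (α): `𝒯` finite for
the complete toric germ (finite divisor class group) and its identification with the monomial ideals `C_w·C_{-w}`. No definitions,
no named facts, no sorry. [folklore; cite: Matsumura1987, §11 (divisorial ideals)] [cite: StacksProject, Tag 0AUU]
-/

-- single-problem summit: the doubled namespace component is forced
set_option linter.dupNamespace false

namespace Summit.ResolutionOfSingularities.ResolutionOfSingularities.Theorems.FRationalResolution.DivisorialIdealsCharacteristic

open TraceIdealCharacteristic

universe u

/-- Principal ideals are transported: `z ∈ (a) ⇒ θ z ∈ (θ a)`. [folklore] -/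
theorem map_mem_span_singleton {A B : Type u} [CommRing A] [CommRing B] (θ : A ≃+* B) {a z : A}
    (h : z ∈ Ideal.span ({a} : Set A)) : θ z ∈ Ideal.span ({θ a} : Set B) := by
  obtain ⟨c, rfl⟩ := Ideal.mem_span_singleton'.mp h
  exact Ideal.mem_span_singleton'.mpr ⟨θ c, by rw [map_mul]⟩

/-- **«Nonzero divisorial» is transported by ring isomorphisms.** [folklore; cite: Matsumura1987, §11] -/
theorem divisorial_map_ringEquiv {A B : Type u} [CommRing A] [CommRing B] (θ : A ≃+* B) (I : Ideal A)
    (hI : I ≠ ⊥ ∧ ∀ x : A, (∀ a b : A, (∀ y ∈ I, b * y ∈ Ideal.span ({a} : Set A)) → b * x ∈ Ideal.span ({a} : Set A)) → x ∈ I) :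
    I.map θ ≠ ⊥ ∧
      ∀ x : B, (∀ a b : B, (∀ y ∈ I.map θ, b * y ∈ Ideal.span ({a} : Set B)) → b * x ∈ Ideal.span ({a} : Set B)) →
        x ∈ I.map θ := by
  obtain ⟨hI0, hdiv⟩ := hI
  refine ⟨fun h => hI0 ?_, fun x hx => ?_⟩
  · rw [Ideal.map_eq_bot_iff_of_injective θ.injective] at h
    exact h
  · rw [← Ideal.symm_apply_mem_of_equiv_iff]
    refine hdiv (θ.symm x) fun a b hab => ?_
    -- transport the test `(a, b)` to `(θ a, θ b)`
    have hab' : ∀ y ∈ I.map θ, θ b * y ∈ Ideal.span ({θ a} : Set B) := by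
      intro y hy
      have hy' : θ.symm y ∈ I := Ideal.symm_apply_mem_of_equiv_iff.mpr hy
      have h := map_mem_span_singleton θ (hab (θ.symm y) hy')
      rwa [map_mul, RingEquiv.apply_symm_apply] at h
    have h := map_mem_span_singleton θ.symm (hx (θ a) (θ b) hab')
    rwa [map_mul, RingEquiv.symm_apply_apply, RingEquiv.symm_apply_apply] at h

/-- ★ **The product of the trace ideals of the nonzero divisorial ideals is characteristic** (when there are finitely many such
trace ideals — e.g. finite divisor class group): for every ring automorphism `θ`, `θ(∏_{T ∈ 𝒯} T) = ∏_{T ∈ 𝒯} T`. [folklore] -/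
theorem map_prod_traceIdeal_divisorial_eq {A : Type u} [CommRing A]
    (hfin : Set.Finite {T : Ideal A | ∃ I : Ideal A,
      (I ≠ ⊥ ∧ ∀ x : A, (∀ a b : A, (∀ y ∈ I, b * y ∈ Ideal.span ({a} : Set A)) → b * x ∈ Ideal.span ({a} : Set A)) → x ∈ I) ∧
      T = ⨆ φ : I →ₗ[A] A, LinearMap.range φ})
    (θ : A ≃+* A) : (∏ T ∈ hfin.toFinset, T).map θ = ∏ T ∈ hfin.toFinset, T :=
  map_prod_traceIdeal_eq _ (fun θ I hI => divisorial_map_ringEquiv θ I hI) hfin θ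

/-- The `hchar` slot of p838347 / `…CharacteristicTower`, verbatim: `∀ θ, θ(𝔞_tot) ⊆ 𝔞_tot`. [folklore] -/
theorem forall_map_prod_traceIdeal_divisorial_le {A : Type u} [CommRing A]
    (hfin : Set.Finite {T : Ideal A | ∃ I : Ideal A,
      (I ≠ ⊥ ∧ ∀ x : A, (∀ a b : A, (∀ y ∈ I, b * y ∈ Ideal.span ({a} : Set A)) → b * x ∈ Ideal.span ({a} : Set A)) → x ∈ I) ∧
      T = ⨆ φ : I →ₗ[A] A, LinearMap.range φ}) :
    ∀ θ : A ≃+* A, (∏ T ∈ hfin.toFinset, T).map θ ≤ ∏ T ∈ hfin.toFinset, T :=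
  fun θ => (map_prod_traceIdeal_divisorial_eq hfin θ).le

/-- Powers of `𝔞_tot` are characteristic as well (the interface wants an ideal containing a power of the maximal ideal; one takes
`𝔞_totᴺ` or a normalized power). [folklore] -/
theorem forall_map_pow_prod_traceIdeal_divisorial_le {A : Type u} [CommRing A]
    (hfin : Set.Finite {T : Ideal A | ∃ I : Ideal A,
      (I ≠ ⊥ ∧ ∀ x : A, (∀ a b : A, (∀ y ∈ I, b * y ∈ Ideal.span ({a} : Set A)) → b * x ∈ Ideal.span ({a} : Set A)) → x ∈ I) ∧
      T = ⨆ φ : I →ₗ[A] A, LinearMap.range φ}) (N : ℕ) :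
    ∀ θ : A ≃+* A, ((∏ T ∈ hfin.toFinset, T) ^ N).map θ ≤ (∏ T ∈ hfin.toFinset, T) ^ N := by
  intro θ
  rw [Ideal.map_pow, map_prod_traceIdeal_divisorial_eq hfin θ]

end Summit.ResolutionOfSingularities.ResolutionOfSingularities.Theorems.FRationalResolution.DivisorialIdealsCharacteristic
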